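import Summits.QuantumFields.YangMills.Theorems.BalabanUVNodesN15CurvedGluingLocalGaugesTwoGridTwisted
import Summits.QuantumFields.YangMills.Theorems.BalabanUVNodesN15TwoGridCovDPieceDefect
import HarnessLib

/-!
# N15 = NE2, road (c) — PROGRAMME (PC), (PC-E-J) GROUNDWORK: THE PER-PIECE CONVERSION FOR THE GRADIENT ENTRY — the twisted-transport two-grid defect of `D_U ∘ (M_{W′ᵀ}X′M_{W′})`
# vs `D_U ∘ (M_{(W′σ)ᵀ}XM_{W′σ})` (a dressed cube conjugated into its cube gauge, the covariant derivative of the RAW field in front) from the FLAT data of the INNER jet piece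
# `D_{U^{W′}}∘X` (n15-c∕333 `hasMaj_idef_conj_tr` after n15-c∕400's gauge law) (dag-n15-c g35, n15-c∕401)

Cell `pub-ymgap`, seat `pub-ymgap-dag-n15-c` (generation g35; R134 (a) seat, strategy s1 «first missing estimate»; HUMAN RULING D-0062; chair R424 venue).
`bears_on: R4∕N15 · K3⁸ SpineGivenEndpointR13SepCoPHV (stmt-QuantumFields-27366)`; filed `--kind proof --supports stmt-QuantumFields-27366 --as helper` — COUNT-NEUTRAL.
TWO theorems, 0 `def`, 0 `sorry`; bookkeeping.  Imports BY NAME n15-c∕333 `…CurvedGluingLocalGaugesTwoGridTwisted` (★★★ `hasMaj_idef_conj_tr`) and n15-c∕400 `…TwoGridCovDPieceDefect`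
(`covD_comp_conj_eq`, v1.1 `hasMaj_idef_covD_comp_loc_gtr`).  Nothing in the tree is modified, no landed name re-declared.

WHY (PCJ-DESIGN-g35.md §2 «per-piece twist»).  n15-c∕399's slot `hIDGc` (the two-grid defect THROUGH `τ` of `D∘(χ_□G_□)` for the gauged pieces `G_□ = M_{W_□ᵀ}X_□M_{W_□}` of the (PC-E) glue)
is, by the gauge law `D_U∘M_{Wᵀ} = M_{Wᵀ}∘D_{U^W}` (n15-c∕270∕400), the conjugate of the INNER jet piece `Z_□ = D_{V_□}∘X_□` (`V_□ = U^{w_□}` the SMALL cube-gauged field), and n15-c∕333's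
per-piece conversion turns the FLAT rows∕defect of `Z_□` (n15-c∕400 from dag-n15-w3's dressed-cube jets + shift + coefficient defects) into the twisted defect of the conjugate.

CONTENTS.
* §1 ★★★ `hasMaj_idef_conj_covD_tr` — 333's `hasMaj_idef_conj_tr` for `Y′ := D′_{R′♯}∘X′`, `Y := D_{R♯}∘X` (inner transporters `R♯ = W·R·W(s·)ᵀ`), restated for the OUTER operators
  `D_{R′}∘(M_{W′ᵀ}X′M_{W′})`, `D_R∘(M_{(W′σ)ᵀ}XM_{W′σ})`: `≤ |κ|²·(K_D + s·K′ + s·K)`; input plateau from `X′∘M_{ψ′} = X′`, output plateau `M_ψ∘(D_{R♯}∘X) = D_{R♯}∘X` displayed.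
* §2 ★★★ `hasMaj_idef_conj_covD_loc_tr` — the same with n15-c∕400's flat jet data plugged in (localized currency `1_S1_S·(…)·e^{−δd}`): the `hIDGc`-shaped row
  `|κ|²·((m₁ + c_am_S + o_aβ_S) + s·β₁′ + s·β₁)`.

HONEST FRAMING ∕ LIMITS.  Generic bookkeeping; the inner jet rows (`β₁′`, `β₁`), the flat jet∕shift∕coefficient defects and the plateau∕stair data are HYPOTHESES (their (PC-E) producers are the
successor's cube-level file).  Nothing of [B9] asserted; NE2⁺ NOT PRINTED ∕ NOT proved; N15 of record untouched (DISCHARGED AS CONSUMED, p687738); K3⁸ OPEN; counts of record UNMOVED (typed 28∕28 ·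
discharged 8∕27); one finite 𝕋⁴ at fixed ε per index — NOT infinite volume, NOT OS on ℝ⁴, NOT a mass gap, NOT Clay.  Restate-immune (no Theses import).
-/

noncomputable section
open scoped BigOperators Matrix
open Finset

namespace Summit.QuantumFields.YangMills.BalabanUVNodes.N15.Gluing

open Literature.MathematicalPhysics.QuantumFieldTheory.Balaban1983to89
open Literature.MathematicalPhysics.QuantumFieldTheory.Balaban1983to89.B11SectG (BlockNorm HasMaj)
open Literature.MathematicalPhysics.QuantumFieldTheory.Balaban1983to89.T4EtaRateDefect (idef idef_comp idef_add)
open Literature.MathematicalPhysics.QuantumFieldTheory.Balaban1983to89.T4EtaRateCoeffDefect (pull pull_apply diagK diagK_nonneg)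
open Literature.MathematicalPhysics.QuantumFieldTheory.Balaban1983to89.B6Prop26Gluing (mulOp mulOp_apply ind ind_nonneg)
open Summit.QuantumFields.YangMills.BalabanUVNodes.N15.MatrixSpecies (mmulOp mmulOp_apply liftBlk liftMap liftEquiv covD)
open Summit.QuantumFields.YangMills.BalabanUVNodes.N15.BackgroundLayer (fgrad)
open Summit.QuantumFields.YangMills.BalabanUVNodes.N15.CurvedSpecies (hasMaj_idef_conj_tr)

section Piece

variable {X X' κ : Type} [Fintype X] [Fintype X'] [DecidableEq X] [DecidableEq X'] [Fintype κ] [DecidableEq κ] {g : B6.Geometry} (blk : X → g.Site) (π : X' → X) (sec : X → X')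
  (T : (X × κ → ℝ) →ₗ[ℝ] (X' × κ → ℝ)) (W' Sg : X' → Matrix κ κ ℝ)

omit [DecidableEq X] [DecidableEq X'] in
/-- ★★★ **THE PER-PIECE CONVERSION FOR THE GRADIENT ENTRY.**  Transport `T = M_{W′ᵀ}(M_{Sᵀ}∘pull)M_{W′∘σ}` (`W′` orthogonal); raw transporters `R′` (fine, shift `e′`), `R` (coarse, shift `e`),
inner (cube-gauged) transporters `R′♯(x′) = W′(x′)R′(x′)W′(e′x′)ᵀ`, `R♯(x) = W′(σx)R(x)W′(σ(ex))ᵀ`; dressed cubes `X′` (input plateau `ψ′`), `X`; inner jet pieces `D′_{R′♯}∘X′` with row `K′`,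
`D_{R♯}∘X` with row `K` and output plateau `ψ`; their FLAT defect `𝔇_{pull}(D′_{R′♯}X′, D_{R♯}X) ≤ K_D`; smeared stair letters `s` ⟹
`𝔇_T(D′_{R′}∘(M_{W′ᵀ}X′M_{W′}), D_R∘(M_{(W′σ)ᵀ}XM_{W′σ})) ≤ |κ|²·(K_D + s·K′ + s·K)`. [cite: Balaban1985BackgroundPropagators, (3.34)–(3.35) p.396, (3.42) p.397 (gradient entry), (3.50) p.400, Thm 3.14 pp.426–427 (difference template); Balaban1984PropagatorsII, (2.133)–(2.136) p.247; King1986, p.664 (pairing)] -/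
theorem hasMaj_idef_conj_covD_tr (hW'1 : ∀ v, (W' v)ᵀ * W' v = 1) (hW'2 : ∀ v, W' v * (W' v)ᵀ = 1)
    (hT : T = mmulOp (fun x' => (W' x')ᵀ) ∘ₗ (mmulOp (fun x' => (Sg x')ᵀ) ∘ₗ pull (liftMap π κ)) ∘ₗ mmulOp (fun x => W' (sec x)))
    (η η' : ℝ) (R : X → Matrix κ κ ℝ) (R' : X' → Matrix κ κ ℝ) (e : X → X) (e' : X' → X')
    {X₁' : (X' × κ → ℝ) →ₗ[ℝ] (X' × κ → ℝ)} {X₁ : (X × κ → ℝ) →ₗ[ℝ] (X × κ → ℝ)} {ψ' : X' → ℝ} {ψ : X → ℝ} {s : ℝ} (hs : 0 ≤ s)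
    (hXin : X₁' ∘ₗ mulOp (fun p : X' × κ => ψ' p.1) = X₁')
    (hZout : mulOp (fun p : X × κ => ψ p.1) ∘ₗ (covD η (fun x => W' (sec x) * R x * (W' (sec (e x)))ᵀ) e ∘ₗ X₁) = covD η (fun x => W' (sec x) * R x * (W' (sec (e x)))ᵀ) e ∘ₗ X₁)
    (hSin : ∀ x' i, ∑ j, |(ψ' x' • ((Sg x')ᵀ - 1)) i j| ≤ s) (hSout : ∀ x' i, ∑ j, |(ψ (π x') • ((Sg x')ᵀ - 1)) i j| ≤ s)
    {K' K KD : g.Site → g.Site → ℝ} (hK' : ∀ a b, 0 ≤ K' a b) (hK : ∀ a b, 0 ≤ K a b) (hKD : ∀ a b, 0 ≤ KD a b)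
    (hY' : HasMaj (BlockNorm.ofBlocks g (liftBlk (blk ∘ π) κ)) (BlockNorm.ofBlocks g (liftBlk (blk ∘ π) κ)) (covD η' (fun x' => W' x' * R' x' * (W' (e' x'))ᵀ) e' ∘ₗ X₁') K')
    (hY : HasMaj (BlockNorm.ofBlocks g (liftBlk blk κ)) (BlockNorm.ofBlocks g (liftBlk blk κ)) (covD η (fun x => W' (sec x) * R x * (W' (sec (e x)))ᵀ) e ∘ₗ X₁) K)
    (hD : HasMaj (BlockNorm.ofBlocks g (liftBlk blk κ)) (BlockNorm.ofBlocks g (liftBlk (blk ∘ π) κ))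
      (idef (pull (liftMap π κ)) (pull (liftMap π κ)) (covD η' (fun x' => W' x' * R' x' * (W' (e' x'))ᵀ) e' ∘ₗ X₁') (covD η (fun x => W' (sec x) * R x * (W' (sec (e x)))ᵀ) e ∘ₗ X₁)) KD) :
    HasMaj (BlockNorm.ofBlocks g (liftBlk blk κ)) (BlockNorm.ofBlocks g (liftBlk (blk ∘ π) κ))
      (idef T T (covD η' R' e' ∘ₗ (mmulOp (fun x' => (W' x')ᵀ) ∘ₗ X₁' ∘ₗ mmulOp W')) (covD η R e ∘ₗ (mmulOp (fun x => (W' (sec x))ᵀ) ∘ₗ X₁ ∘ₗ mmulOp (fun x => W' (sec x)))))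
      (fun y y' => (Fintype.card κ : ℝ) ^ 2 * (KD y y' + s * K' y y' + s * K y y')) := by
  have hYin : (covD η' (fun x' => W' x' * R' x' * (W' (e' x'))ᵀ) e' ∘ₗ X₁') ∘ₗ mulOp (fun p : X' × κ => ψ' p.1) = covD η' (fun x' => W' x' * R' x' * (W' (e' x'))ᵀ) e' ∘ₗ X₁' := by
    rw [LinearMap.comp_assoc, hXin]
  have key := hasMaj_idef_conj_tr blk π sec T W' Sg hW'1 hW'2 hT hs hYin hZout hSin hSout hK' hK hKD hY' hY hD
  have e1 := covD_comp_conj_eq hW'1 η' R' e' X₁' (mmulOp W')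
  have e2 := covD_comp_conj_eq (W := fun x => W' (sec x)) (fun x => hW'1 (sec x)) η R e X₁ (mmulOp (fun x => W' (sec x)))
  rw [e1, e2]
  exact key

omit [DecidableEq X] [DecidableEq X'] in
/-- ★★★ **… WITH n15-c∕400's FLAT JET DATA PLUGGED IN** (n15-c∕399's `hIDGc`-shaped row for ONE gauged piece): inner transporters split as `D = ∇ + M_{n(R♯−1)}∘τ_e^*`; from the dressed
cubes' rows (`β₁′` = fine inner jet row, `β₁` = coarse), the flat jet defect `m₁`, the shift defect `m_S`, the shifted row `β_S`, the fine coefficient letter `c_a`, the coefficient defect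
`o_a`, plateaux and stair letters `s`: `𝔇_T(D′∘(M_{W′ᵀ}X′M_{W′}), D∘(M_{(W′σ)ᵀ}XM_{W′σ})) ≤ 1_S1_S·|κ|²·((m₁ + c_am_S + o_aβ_S) + s·β₁′ + s·β₁)·e^{−δd}`.
[cite: Balaban1985BackgroundPropagators, (3.34)–(3.35) p.396, (3.42) p.397, (3.50) p.400, Thm 3.14 pp.426–427 (template); Balaban1984PropagatorsII, (2.133)–(2.136) p.247] -/
theorem hasMaj_idef_conj_covD_loc_tr (hW'1 : ∀ v, (W' v)ᵀ * W' v = 1) (hW'2 : ∀ v, W' v * (W' v)ᵀ = 1)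
    (hT : T = mmulOp (fun x' => (W' x')ᵀ) ∘ₗ (mmulOp (fun x' => (Sg x')ᵀ) ∘ₗ pull (liftMap π κ)) ∘ₗ mmulOp (fun x => W' (sec x)))
    (n n' : ℝ) (R : X → Matrix κ κ ℝ) (R' : X' → Matrix κ κ ℝ) (e : X ≃ X) (e' : X' ≃ X')
    {X₁' : (X' × κ → ℝ) →ₗ[ℝ] (X' × κ → ℝ)} {X₁ : (X × κ → ℝ) →ₗ[ℝ] (X × κ → ℝ)} {ψ' : X' → ℝ} {ψ : X → ℝ} {Sc : Set g.Site} {s β₁ β₁' ca oa m₁ mS βS δ : ℝ}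
    (hs : 0 ≤ s) (hβ₁ : 0 ≤ β₁) (hβ₁' : 0 ≤ β₁') (hca : 0 ≤ ca) (hoa : 0 ≤ oa) (hm₁ : 0 ≤ m₁) (hmS : 0 ≤ mS) (hβS : 0 ≤ βS)
    (hXin : X₁' ∘ₗ mulOp (fun p : X' × κ => ψ' p.1) = X₁')
    (hZout : mulOp (fun p : X × κ => ψ p.1) ∘ₗ (covD n⁻¹ (fun x => W' (sec x) * R x * (W' (sec (e x)))ᵀ) e ∘ₗ X₁) = covD n⁻¹ (fun x => W' (sec x) * R x * (W' (sec (e x)))ᵀ) e ∘ₗ X₁)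
    (hSin : ∀ x' i, ∑ j, |(ψ' x' • ((Sg x')ᵀ - 1)) i j| ≤ s) (hSout : ∀ x' i, ∑ j, |(ψ (π x') • ((Sg x')ᵀ - 1)) i j| ≤ s)
    -- the inner jet rows on both grids
    (hY' : HasMaj (BlockNorm.ofBlocks g (liftBlk (blk ∘ π) κ)) (BlockNorm.ofBlocks g (liftBlk (blk ∘ π) κ)) (covD n'⁻¹ (fun x' => W' x' * R' x' * (W' (e' x'))ᵀ) e' ∘ₗ X₁')
      (fun y y' => ind Sc y * ind Sc y' * (β₁' * Real.exp (-(δ * g.dist y y')))))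
    (hY : HasMaj (BlockNorm.ofBlocks g (liftBlk blk κ)) (BlockNorm.ofBlocks g (liftBlk blk κ)) (covD n⁻¹ (fun x => W' (sec x) * R x * (W' (sec (e x)))ᵀ) e ∘ₗ X₁)
      (fun y y' => ind Sc y * ind Sc y' * (β₁ * Real.exp (-(δ * g.dist y y')))))
    -- n15-c∕400's flat data: coefficient letter∕defect, flat jet defect, shift defect, shifted row
    (ha' : ∀ x' i, ∑ j, |(n' • (W' x' * R' x' * (W' (e' x'))ᵀ - 1)) i j| ≤ ca)
    (hDa : HasMaj (BlockNorm.ofBlocks g (liftBlk blk κ)) (BlockNorm.ofBlocks g (liftBlk (blk ∘ π) κ))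
      (idef (pull (liftMap π κ)) (pull (liftMap π κ)) (mmulOp fun x' => n' • (W' x' * R' x' * (W' (e' x'))ᵀ - 1)) (mmulOp fun x => n • (W' (sec x) * R x * (W' (sec (e x)))ᵀ - 1))) (diagK fun _ => oa))
    (hJ : HasMaj (BlockNorm.ofBlocks g (liftBlk blk κ)) (BlockNorm.ofBlocks g (liftBlk (blk ∘ π) κ))
      (idef (pull (liftMap π κ)) (pull (liftMap π κ)) (fgrad n' (liftEquiv e' κ) ∘ₗ X₁') (fgrad n (liftEquiv e κ) ∘ₗ X₁)) (fun y y' => ind Sc y * ind Sc y' * (m₁ * Real.exp (-(δ * g.dist y y')))))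
    (hDS : HasMaj (BlockNorm.ofBlocks g (liftBlk blk κ)) (BlockNorm.ofBlocks g (liftBlk (blk ∘ π) κ))
      (idef (pull (liftMap π κ)) (pull (liftMap π κ)) (pull (liftEquiv e' κ) ∘ₗ X₁') (pull (liftEquiv e κ) ∘ₗ X₁)) (fun y y' => ind Sc y * ind Sc y' * (mS * Real.exp (-(δ * g.dist y y')))))
    (hSY : HasMaj (BlockNorm.ofBlocks g (liftBlk blk κ)) (BlockNorm.ofBlocks g (liftBlk blk κ)) (pull (liftEquiv e κ) ∘ₗ X₁) (fun y y' => ind Sc y * ind Sc y' * (βS * Real.exp (-(δ * g.dist y y'))))) :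
    HasMaj (BlockNorm.ofBlocks g (liftBlk blk κ)) (BlockNorm.ofBlocks g (liftBlk (blk ∘ π) κ))
      (idef T T (covD n'⁻¹ R' e' ∘ₗ (mmulOp (fun x' => (W' x')ᵀ) ∘ₗ X₁' ∘ₗ mmulOp W')) (covD n⁻¹ R e ∘ₗ (mmulOp (fun x => (W' (sec x))ᵀ) ∘ₗ X₁ ∘ₗ mmulOp (fun x => W' (sec x)))))
      (fun y y' => ind Sc y * ind Sc y' * ((Fintype.card κ : ℝ) ^ 2 * ((m₁ + ca * mS + oa * βS) + s * β₁' + s * β₁) * Real.exp (-(δ * g.dist y y')))) := by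
  have hnn : ∀ (c : ℝ), 0 ≤ c → ∀ y y' : g.Site, 0 ≤ ind Sc y * ind Sc y' * (c * Real.exp (-(δ * g.dist y y'))) :=
    fun c hc y y' => mul_nonneg (mul_nonneg (ind_nonneg _ _) (ind_nonneg _ _)) (mul_nonneg hc (Real.exp_nonneg _))
  have hD := hasMaj_idef_covD_comp_loc_gtr blk π (BlockNorm.ofBlocks g (liftBlk blk κ)) (pull (liftMap π κ)) (pull (liftMap π κ)) e e' hca hoa ha' hDa hJ hDS hSY
  refine (hasMaj_idef_conj_covD_tr blk π sec T W' Sg hW'1 hW'2 hT n⁻¹ n'⁻¹ R R' e e' hs hXin hZout hSin hSout (hnn β₁' hβ₁') (hnn β₁ hβ₁)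
    (hnn _ (by positivity)) hY' hY hD).mono fun y y' => le_of_eq ?_
  ring

end Piece

end Summit.QuantumFields.YangMills.BalabanUVNodes.N15.Gluing

end
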